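import Summits.CriticalPhenomena.SAWScalingLimit.Theses.SAWConePseudogroup
import Literature.Probability.RandomPlanarGeometry.SAWScalingLimitFamily

/-!
# `SAWConePseudogroup.EndpointApproxExists` (stmt-CriticalPhenomena-4455): every Dobrushin domain
admits an endpoint approximation

Route `SAWConePseudogroup` of `CriticalPhenomena/SAWScalingLimit`, support item
`EndpointApproxExists` (shared statement item stmt-CriticalPhenomena-4455): for every Dobrushin
domain `D = (Ω; a, b)` there are lattice endpoints `a_δ, b_δ : ℝ → Site 2` forming an endpoint
approximation (`SAW.IsEndpointApprox D a b`): joined in the discrete domain `Ω_δ` for all small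
`δ > 0`, with mesh points `δ·a_δ → a`, `δ·b_δ → b` as `δ → 0⁺`.

## Proof

The body of the route decl is, verbatim, the Literature theorem
`Literature.Probability.RandomPlanarGeometry.SAW.exists_isEndpointApprox`
(`Literature/Probability/RandomPlanarGeometry/SAWScalingLimitFamily.lean`, proved in the tree:
interior points `z_n → a`, `w_n → b` with closed discs inside `Ω`; the largest mesh component of a
Jordan domain eventually contains every compact and is connected there,
`JordanDomain.exists_forall_mem_meshDomain_and_reachable`, `MeshDomainJordan.lean`; a diagonal
stage selection `n = N(δ) → ∞` along `δ → 0⁺`). We unfold and apply it.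

References: Ch. Pommerenke, *Boundary behaviour of conformal maps* (1992), Ch. 2 (local
connectivity of Jordan boundaries); S. Smirnov, C. R. Acad. Sci. Paris 333 (2001), §2
(largest-component discretisation).
-/

namespace Summit.CriticalPhenomena.SAWScalingLimit.Theorems

open Literature.Probability.RandomPlanarGeometry

/-- **`SAWConePseudogroup.EndpointApproxExists` (stmt-CriticalPhenomena-4455) holds**: every
Dobrushin domain `D` admits an endpoint approximation `(a_δ, b_δ)` (`SAW.IsEndpointApprox D a b`).
Immediate from the tree theorem `SAW.exists_isEndpointApprox` (largest mesh component of a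
Jordan domain is the bulk + diagonal stage selection). -/
theorem EndpointApproxExists_proof :
    Summit.CriticalPhenomena.SAWScalingLimit.Theses.SAWConePseudogroup.EndpointApproxExists := by
  unfold Summit.CriticalPhenomena.SAWScalingLimit.Theses.SAWConePseudogroup.EndpointApproxExists
  intro D
  exact SAW.exists_isEndpointApprox D

end Summit.CriticalPhenomena.SAWScalingLimit.Theorems
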